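import Mathlib
import HarnessLib
import Summits.HodgeConjecture.HodgeConjecture.Theses.KleimanBFSeeds
import Literature.AlgebraicGeometry.HodgeTheory.TwistNormalisedChernCharacter

/-!
# Crux `KleimanChernCharacterOnBetti` (stmt-HodgeConjecture-26526, route `KleimanBFSeeds`) from the shared
construction item `Nonempty ChernCharacterBetti` (stmt-HodgeConjecture-19780) and Fulton's presentation fact

HONEST FRAMING: a CONDITIONAL helper (`--supports stmt-HodgeConjecture-26526`). It constructs NO Chern
character on Betti cohomology and proves nothing toward K2, rung H2, HC_AV, HC_CM or HC. It records, as a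
kernel-checked implication concluding the route declaration BY NAME, the reduction found by the typer seat
hodge-chernbetti-typer-1 g0 (Literature theorem
`Literature.AlgebraicGeometry.HodgeTheory.exists_kleimanChernNormalForm_of_nonempty`, p782910):

  `Nonempty ChernCharacterBetti` (item 19780, a CONSTRUCTION — open)
  `∧ KTheory.Fulton1998_chernCharacter_presentsAlgebraicClasses` (Literature NAMED FACT, unproved `def … : Prop`)
  `→ Theses.KleimanBFSeeds.KleimanChernCharacterOnBetti` (`= ∃ C, C.KleimanChernNormalForm`).

So the crux K-C⁺ is EXACTLY the shared construction crux plus one citation; its registered birth-line stub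
`stub_virtualComplements` (`∃ C, SumVirtualNormalForm C ∧ HTrivialComplements C`, skeleton
`Cruxes/KleimanChernCharacterOnBetti/Lines/birth.lean`) asks for nothing a construction of `C` would not give
through the same citation. [cite: Fulton1998, Example 15.3.2 (PDF p. 286) and Example 15.2.16 (b) (PDF p. 283)]
-/

-- every declaration of this problem lives in `Summit.HodgeConjecture.HodgeConjecture.…` (summit = sub-problem)
set_option linter.dupNamespace false

noncomputable section

namespace Summit.HodgeConjecture.HodgeConjecture.Theorems

open Literature.AlgebraicGeometry.HodgeTheory

/-- **K-C⁺ from the shared construction item and Fulton's presentation fact** (conditional, by name): a Chern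
character on complex Betti cohomology (`Nonempty ChernCharacterBetti`, item stmt-HodgeConjecture-19780) has
Kleiman's normal form as soon as vector bundles present algebraic classes modulo powers of the hyperplane class
(`KTheory.Fulton1998_chernCharacter_presentsAlgebraicClasses`, Fulton Ex. 15.2.16 (b) + 15.3.2), hence
witnesses `KleimanChernCharacterOnBetti`. [cite: Fulton1998, Example 15.3.2 (PDF p. 286) and Example 15.2.16 (b) (PDF p. 283)] -/
theorem kleimanChernCharacterOnBetti_of_nonempty_chernCharacterBetti
    (hCC : Nonempty ChernCharacterBetti)
    (hF : Literature.AlgebraicGeometry.KTheory.Fulton1998_chernCharacter_presentsAlgebraicClasses) :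
    Summit.HodgeConjecture.HodgeConjecture.Theses.KleimanBFSeeds.KleimanChernCharacterOnBetti := by
  unfold Summit.HodgeConjecture.HodgeConjecture.Theses.KleimanBFSeeds.KleimanChernCharacterOnBetti
  exact exists_kleimanChernNormalForm_of_nonempty hCC hF

/-- The same reduction with the Chern character GIVEN (every `C : ChernCharacterBetti` witnesses the crux under
Fulton's presentation fact, by `ChernCharacterBetti.kleimanChernNormalForm_of_presentsAlgebraicClasses`).
[cite: Fulton1998, Example 15.3.2 (PDF p. 286) and Example 15.2.16 (b) (PDF p. 283)] -/
theorem kleimanChernCharacterOnBetti_of_chernCharacterBetti (C : ChernCharacterBetti)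
    (hF : Literature.AlgebraicGeometry.KTheory.Fulton1998_chernCharacter_presentsAlgebraicClasses) :
    Summit.HodgeConjecture.HodgeConjecture.Theses.KleimanBFSeeds.KleimanChernCharacterOnBetti :=
  kleimanChernCharacterOnBetti_of_nonempty_chernCharacterBetti ⟨C⟩ hF

end Summit.HodgeConjecture.HodgeConjecture.Theorems

end
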